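import Literature.NumberTheory.DiophantineGeometry.FaltingsHeightIsogenyReductionProofs
import Literature.NumberTheory.DiophantineGeometry.JDenominatorIdealCountProofs
import HarnessLib

/-!
# Faltings' isogeny inequality for elliptic curves: reduction to a statement at each finite place

Topic `NumberTheory/DiophantineGeometry`; a proofs-only file (one theorem: no definitions, no
named facts) combining `FaltingsHeightIsogenyReductionProofs`
(`stableFaltingsHeight_le_of_isogeny_of_finitePart`: the named fact
`WeierstrassCurve.stableFaltingsHeight_le_of_isogeny` follows from the fractional-ideal inequality
`𝔇_E · (Δ_{E'}α₀¹²/Δ_E) ⊆ 𝔇_{E'}` for the multiplier `α₀` of a `K`-isogeny between short models)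
with `JDenominatorIdealCountProofs` (`ord_v 𝔇 = max(0, −ord_v j)` and local-to-global) into the
**per-prime form** of what remains to be proved of Faltings 1983, §3, Lemma 5 for elliptic
curves:

  (D_v) for short Weierstrass models `E, E'` of elliptic curves over a number field `K`, an
  isogeny `ψ : E → E'` over `K` with multiplier `α₀ ∈ Kˣ` (`ψ^*ω' = α₀ω`, characterised by the
  coordinate identity `α₀ · 2P₂Q₁² = (δP₁·Q₁ − P₁·δQ₁)·Q₂` on `E(K̄)`), and every maximal ideal
  `v` of `𝓞_K`:  `max(0, −ord_v j(E')) ≤ max(0, −ord_v j(E)) + ord_v(Δ_{E'} α₀¹² / Δ_E)`.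

(D_v) is the statement "`φ^*` is integral on Néron differentials at `v` over a field of
semistable reduction" (the term `#s^*Ω¹_{G/R} ≥ 1` of Faltings' proof), read through Silverman's
`(j) = 𝔄𝔇⁻¹`: at a place of potentially good reduction of both curves it says
`ord_v(Δ_{E'}α₀¹²/Δ_E) ≥ 0`, at a place of potentially multiplicative reduction
`ord_v(c₄(E')α₀⁴/c₄(E)) ≥ 0`. It is **not** proved in the tree (no reduction theory of isogenies
at finite places) and enters as an explicit hypothesis schema.

* `WeierstrassCurve.stableFaltingsHeight_le_of_isogeny_of_localPart` — **(D_v) for all `v`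
  implies the named fact.**

## References

* [Faltings1986FinitenessTranslation] G. Faltings, *Finiteness theorems for abelian varieties
  over number fields*, in Cornell–Silverman, *Arithmetic Geometry*, Ch. II, §3, Lemma 5 and its
  proof.
* [Silverman1986] J. H. Silverman, *Heights and elliptic curves*, ibid. Ch. X, §2.
-/

noncomputable section

open scoped Classical nonZeroDivisors

namespace WeierstrassCurve

open NumberField IsDedekindDomain

/-- **Faltings' isogeny inequality for elliptic curves from its per-prime finite part.** Assume
(D_v): for short Weierstrass models `E, E'` (`a₁ = a₂ = a₃ = 0`) of elliptic curves over a number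
field `K`, an isogeny `ψ : E → E'` over `K`, `α₀ ∈ Kˣ` with the coordinate identity
`α₀ · (2P₂Q₁²)(x, y) = ((δP₁·Q₁ − P₁·δQ₁)·Q₂)(x, y)` on `E(K̄)` for all rational representations
of `ψ` (`ψ^*ω' = α₀ω`, Silverman *AEC* III.5), and every maximal ideal `v` of `𝓞_K`,
`max(0, −ord_v j(E')) ≤ max(0, −ord_v j(E)) + ord_v(Δ_{E'}α₀¹²/Δ_E)` (with
`ord_v x = FractionalIdeal.count K v (spanSingleton x)`). Then
`h_F(E') ≤ h_F(E) + ½ log deg φ` for every isogeny of elliptic curves over a number field (the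
named fact `stableFaltingsHeight_le_of_isogeny`): the per-prime inequalities give
`𝔇_E · (Δ'α₀¹²/Δ) ⊆ 𝔇_{E'}` (`coeIdeal_jDenominatorIdeal_mul_spanSingleton_le`, i.e.
`ord_v 𝔇 = max(0, −ord_v j)`), which is the hypothesis of
`stableFaltingsHeight_le_of_isogeny_of_finitePart`. (Dot-notation extension of Mathlib's
`WeierstrassCurve`.) [cite: Faltings1986FinitenessTranslation, §3 Lemma 5 (proof)] -/
theorem stableFaltingsHeight_le_of_isogeny_of_localPart
    (hloc : ∀ {K : Type} [Field K] [NumberField K] {E E' : WeierstrassCurve K} [E.IsElliptic]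
      [E'.IsElliptic] (ψ : Isogeny E E') {α₀ : K},
      E.a₁ = 0 → E.a₂ = 0 → E.a₃ = 0 → E'.a₁ = 0 → E'.a₂ = 0 → E'.a₃ = 0 → α₀ ≠ 0 →
      (∀ (ρ : RatRep E E' ψ) (x y : AlgebraicClosure K)
        (_ : (E.baseChange (AlgebraicClosure K)).toAffine.Nonsingular x y),
        algebraMap K (AlgebraicClosure K) α₀ *
            MvPolynomial.eval ![x, y] (MvPolynomial.C 2 * ρ.P₂ * ρ.Q₁ ^ 2) =
          MvPolynomial.eval ![x, y]
            (((E.baseChange (AlgebraicClosure K)).invariantDerivation ρ.P₁ * ρ.Q₁ -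
              ρ.P₁ * (E.baseChange (AlgebraicClosure K)).invariantDerivation ρ.Q₁) * ρ.Q₂)) →
      ∀ v : HeightOneSpectrum (𝓞 K),
        max 0 (-FractionalIdeal.count K v (FractionalIdeal.spanSingleton (𝓞 K)⁰ E'.j)) ≤
          max 0 (-FractionalIdeal.count K v (FractionalIdeal.spanSingleton (𝓞 K)⁰ E.j)) +
            FractionalIdeal.count K v
              (FractionalIdeal.spanSingleton (𝓞 K)⁰ (E'.Δ * α₀ ^ 12 / E.Δ))) :
    stableFaltingsHeight_le_of_isogeny := by
  refine stableFaltingsHeight_le_of_isogeny_of_finitePart ?_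
  intro K _ _ E E' _ _ ψ α₀ h₁ h₂ h₃ h₁' h₂' h₃' hα₀ hcoord
  have hμ : E'.Δ * α₀ ^ 12 / E.Δ ≠ 0 :=
    div_ne_zero (mul_ne_zero E'.isUnit_Δ.ne_zero (pow_ne_zero _ hα₀)) E.isUnit_Δ.ne_zero
  exact coeIdeal_jDenominatorIdeal_mul_spanSingleton_le E E' hμ
    (hloc ψ h₁ h₂ h₃ h₁' h₂' h₃' hα₀ hcoord)

end WeierstrassCurve

end
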